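import Mathlib.GroupTheory.SpecificGroups.Cyclic
import Mathlib.GroupTheory.Index
import Mathlib.Algebra.Order.BigOperators.Group.Finset
import Mathlib.Tactic.Linarith
import Mathlib.Tactic.Ring
import HarnessLib

/-!
# Two obstructions to «complex conjugation lies in a cyclic subgroup of index ≤ 2» (the THIN alternative (α))

COR-CM (cell `pub-hodgecm2`), binder seat b04 (gen 18), count-neutral claim ABELIAN-ODD-PART, sequel CYCLOTOMIC-2POWER,
part A (pure group theory, Mathlib only).  KERNEL ONLY: theorems; no definition, no named fact, no `sorry`.

Gen 16's classification of the abelian CM fields of `2`-power degree (`AbelianTwoPowerClassification`) has the good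
alternative (α) «`c` lies in a cyclic subgroup `⟨z⟩` of index `≤ 2`» (thin kernels).  To decide (α) on the Galois
groups `(ℤ/N)ˣ` of the cyclotomic fields of `2`-power degree two invariants suffice:

* §1 **`exists_mul_self_eq_of_thin`**: in a finite commutative group of order `2^k`, `k ≥ 4`, if `c` (`c² = 1`)
  lies in a cyclic subgroup of index `≤ 2` then `c` is a SQUARE (the subgroup has order `≥ 8`, so `4 ∣ ord z` and
  `c = z^j` with `j` even).  For `(ℤ/N)ˣ` with `4 ∣ N` or `3 ∣ N`, `−1` is not a square.
* §2 **`card_filter_pow_four_le_of_index_le_two`**: if some cyclic subgroup has index `≤ 2` then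
  `#{x : x⁴ = 1} ≤ 8` (at most `4` solutions of `x² = 1` — two in the subgroup, two outside — and squaring maps
  `{x⁴ = 1}` into the `≤ 2` involutions of the subgroup).  For `(ℤ/N)ˣ` with two distinct prime factors
  `p, q ≡ 1 (mod 4)` of `N` there are `≥ 16` fourth roots of unity.

## References

* [Gordon1999HodgeAVSurvey] B. B. Gordon, *A survey of the Hodge conjecture for abelian varieties*, §9.4.3.
* [Washington1997] L. C. Washington, *Introduction to Cyclotomic Fields*, Thm. 2.5.

Provenance: Literature home (family `hodge`, namespace `Literature.GroupTheory.ThinObstruction`) of the Summits-side `CorCM/ThinTwoGroupObstructions` (cell `pub-hodgecm2`, COR-CM; all its imports are `Literature/` and Mathlib), which `Literature/` may not import; theorems only, no named fact, no definition. Nothing here bears on `HC_CM`. Lane `lit-hodgefound` (Layer A3: CM types, their Kubota ranks and Galois combinatorics), seat p20.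
-/

namespace Literature.GroupTheory.ThinObstruction

open scoped Classical

variable {G : Type*} [CommGroup G] [Fintype G]

/-! ## §1 In a `2`-group of order `≥ 16`, an involution in a cyclic subgroup of index `≤ 2` is a square -/

/-- The order of a cyclic subgroup of index `≤ 2` is at least half the group order. [cite: Gordon1999HodgeAVSurvey, §9.4.3] -/
theorem card_le_two_mul_orderOf {z : G} (hidx : (Subgroup.zpowers z).index ≤ 2) :
    Fintype.card G ≤ 2 * orderOf z := by
  have h := (Subgroup.zpowers z).index_mul_card
  rw [Nat.card_zpowers, Nat.card_eq_fintype_card] at h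
  calc Fintype.card G = (Subgroup.zpowers z).index * orderOf z := h.symm
    _ ≤ 2 * orderOf z := Nat.mul_le_mul_right _ hidx

/-- **Obstruction 1.**  `|G| = 2^k`, `k ≥ 4`, `c² = 1`, `c ∈ ⟨z⟩` with `[G : ⟨z⟩] ≤ 2` ⟹ `c = w²` for some `w`
(`ord z = 2^r ≥ 8`, `c = z^j`, `ord z ∣ 2j` forces `j` even). [cite: Gordon1999HodgeAVSurvey, §9.4.3] -/
theorem exists_mul_self_eq_of_thin {k : ℕ} (hcard : Fintype.card G = 2 ^ k) (hk : 4 ≤ k) {c z : G}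
    (hcc : c * c = 1) (hc : c ∈ Subgroup.zpowers z) (hidx : (Subgroup.zpowers z).index ≤ 2) :
    ∃ w : G, w * w = c := by
  -- `ord z = 2^r` with `2^r ≥ 8`, hence `4 ∣ ord z`
  have hdvd : orderOf z ∣ 2 ^ k := hcard ▸ orderOf_dvd_card
  obtain ⟨r, -, hr⟩ := (Nat.dvd_prime_pow Nat.prime_two).1 hdvd
  have hge : Fintype.card G ≤ 2 * orderOf z := card_le_two_mul_orderOf hidx
  have h4 : 4 ∣ orderOf z := by
    rw [hr, hcard, show 2 * 2 ^ r = 2 ^ (r + 1) by ring] at hge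
    have hkr : k ≤ r + 1 := (Nat.pow_le_pow_iff_right (by norm_num : 1 < 2)).1 hge
    have h2r : 2 ≤ r := by omega
    rw [hr]
    have h := Nat.pow_dvd_pow 2 h2r
    norm_num at h
    exact h
  -- `c = z^j` with `ord z ∣ 2j`, so `j` is even
  obtain ⟨j, hj⟩ := (Submonoid.mem_powers_iff _ _).1 (mem_powers_iff_mem_zpowers.2 hc)
  have hz2j : z ^ (2 * j) = 1 := by rw [mul_comm, pow_mul, hj, pow_two, hcc]
  have hord : orderOf z ∣ 2 * j := orderOf_dvd_of_pow_eq_one hz2j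
  obtain ⟨t, ht⟩ := h4
  have hjeven : 2 ∣ j := by
    rw [ht] at hord
    obtain ⟨s, hs⟩ := hord
    exact ⟨t * s, by linarith⟩
  obtain ⟨i, rfl⟩ := hjeven
  exact ⟨z ^ i, by rw [← pow_add, ← two_mul, hj]⟩

/-- **Obstruction 1, sharp form.**  `|G| = 2^k`, `k ≥ 2`, `c² = 1`, `c ∈ ⟨z⟩` with `[G : ⟨z⟩] ≤ 2` ⟹
`c = w^{2^{k−2}}` for some `w` (`ord z = 2^r` with `r ≥ k − 1`, `c = z^j` with `2^{r−1} ∣ j`).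
[cite: Gordon1999HodgeAVSurvey, §9.4.3] -/
theorem exists_pow_eq_of_thin {k : ℕ} (hcard : Fintype.card G = 2 ^ k) (hk : 2 ≤ k) {c z : G}
    (hcc : c * c = 1) (hc : c ∈ Subgroup.zpowers z) (hidx : (Subgroup.zpowers z).index ≤ 2) :
    ∃ w : G, w ^ 2 ^ (k - 2) = c := by
  have hdvd : orderOf z ∣ 2 ^ k := hcard ▸ orderOf_dvd_card
  obtain ⟨r, -, hr⟩ := (Nat.dvd_prime_pow Nat.prime_two).1 hdvd
  have hge : Fintype.card G ≤ 2 * orderOf z := card_le_two_mul_orderOf hidx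
  rw [hr, hcard, show 2 * 2 ^ r = 2 ^ (r + 1) by ring] at hge
  have hkr : k ≤ r + 1 := (Nat.pow_le_pow_iff_right (by norm_num : 1 < 2)).1 hge
  -- `c = z^j`, `2^r ∣ 2j`
  obtain ⟨j, hj⟩ := (Submonoid.mem_powers_iff _ _).1 (mem_powers_iff_mem_zpowers.2 hc)
  have hz2j : z ^ (2 * j) = 1 := by rw [mul_comm, pow_mul, hj, pow_two, hcc]
  have hord : orderOf z ∣ 2 * j := orderOf_dvd_of_pow_eq_one hz2j
  rw [hr] at hord
  -- `2^{k-2} ∣ j`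
  have hkj : 2 ^ (k - 2) ∣ j := by
    have h1 : 2 ^ (r - 1) ∣ j := by
      rcases Nat.eq_zero_or_pos r with h0 | hpos
      · rw [h0]
        exact one_dvd j
      · have h2 : 2 ^ r = 2 * 2 ^ (r - 1) := by
          rw [← pow_succ']
          congr 1
          omega
        rw [h2] at hord
        exact Nat.dvd_of_mul_dvd_mul_left two_pos hord
    exact dvd_trans (Nat.pow_dvd_pow 2 (by omega)) h1
  obtain ⟨i, rfl⟩ := hkj
  exact ⟨z ^ i, by rw [← pow_mul, mul_comm, hj]⟩

/-! ## §2 A cyclic subgroup of index `≤ 2` bounds the fourth roots of unity by `8` -/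

/-- Solutions of `x^n = 1` inside a cyclic subgroup `Z`: at most `n`. [cite: Gordon1999HodgeAVSurvey, §9.4.3] -/
theorem card_filter_pow_eq_one_mem_le (Z : Subgroup G) [IsCyclic Z] {n : ℕ} (hn : 0 < n) :
    (Finset.univ.filter fun x : G => x ∈ Z ∧ x ^ n = 1).card ≤ n := by
  have hZ := IsCyclic.card_pow_eq_one_le (α := Z) hn
  refine le_trans ?_ hZ
  refine Finset.card_le_card_of_injOn (fun x : G => if hx : x ∈ Z then (⟨x, hx⟩ : Z) else 1) ?_ ?_
  · intro x hx
    simp only [Finset.coe_filter, Finset.mem_univ, true_and, Set.mem_setOf_eq] at hx ⊢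
    rw [dif_pos hx.1]
    exact Subtype.ext (by simpa using hx.2)
  · intro x hx y hy hxy
    simp only [Finset.coe_filter, Finset.mem_univ, true_and, Set.mem_setOf_eq] at hx hy
    have h := hxy
    simp only [dif_pos hx.1, dif_pos hy.1, Subtype.mk.injEq] at h
    exact h

/-- With a subgroup `Z` of index `2` in a commutative group: the involutions outside `Z` are a translate of a subset of
the involutions inside `Z`. [cite: Gordon1999HodgeAVSurvey, §9.4.3] -/
theorem card_filter_sq_not_mem_le (Z : Subgroup G) (h2 : Z.index = 2) :
    (Finset.univ.filter fun x : G => x ∉ Z ∧ x ^ 2 = 1).card ≤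
      (Finset.univ.filter fun x : G => x ∈ Z ∧ x ^ 2 = 1).card := by
  by_cases hne : (Finset.univ.filter fun x : G => x ∉ Z ∧ x ^ 2 = 1).Nonempty
  · obtain ⟨t₀, ht₀⟩ := hne
    simp only [Finset.mem_filter, Finset.mem_univ, true_and] at ht₀
    refine Finset.card_le_card_of_injOn (fun x => x * t₀⁻¹) ?_ ?_
    · intro x hx
      simp only [Finset.coe_filter, Finset.mem_univ, true_and, Set.mem_setOf_eq] at hx ⊢
      refine ⟨?_, by rw [mul_pow, inv_pow, hx.2, ht₀.2, inv_one, mul_one]⟩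
      rw [Subgroup.mul_mem_iff_of_index_two h2, Subgroup.inv_mem_iff]
      exact ⟨fun h => absurd h hx.1, fun h => absurd h ht₀.1⟩
    · intro x _ y _ hxy
      exact mul_right_cancel hxy
  · rw [Finset.not_nonempty_iff_eq_empty.1 hne, Finset.card_empty]
    exact Nat.zero_le _

/-- **Obstruction 2.**  If a cyclic subgroup `⟨z⟩` has index `≤ 2` in the finite commutative group `G`, then
`#{x ∈ G : x⁴ = 1} ≤ 8`. [cite: Gordon1999HodgeAVSurvey, §9.4.3] -/
theorem card_filter_pow_four_le_of_index_le_two {z : G} (hidx : (Subgroup.zpowers z).index ≤ 2) :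
    (Finset.univ.filter fun x : G => x ^ 4 = 1).card ≤ 8 := by
  set Z := Subgroup.zpowers z with hZ
  haveI : IsCyclic Z := by rw [hZ]; infer_instance
  have hidx0 : Z.index ≠ 0 := Subgroup.index_ne_zero_of_finite
  rcases Nat.lt_or_ge Z.index 2 with h1 | h2
  · -- index `1`: `G = ⟨z⟩` is cyclic
    have hidx1 : Z.index = 1 := by omega
    have htop : Z = ⊤ := Subgroup.index_eq_one.1 hidx1
    have h := card_filter_pow_eq_one_mem_le Z (n := 4) (by norm_num)
    have heq : (Finset.univ.filter fun x : G => x ∈ Z ∧ x ^ 4 = 1) =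
        Finset.univ.filter fun x : G => x ^ 4 = 1 := by
      ext x
      simp only [Finset.mem_filter, Finset.mem_univ, true_and, htop, Subgroup.mem_top]
    rw [heq] at h
    omega
  · have h2' : Z.index = 2 := le_antisymm hidx h2
    -- involutions: at most `2` inside `Z`, at most `2` outside
    have hI_in := card_filter_pow_eq_one_mem_le Z (n := 2) two_pos
    have hI_out := card_filter_sq_not_mem_le Z h2'
    have hI : (Finset.univ.filter fun x : G => x ^ 2 = 1).card ≤ 4 := by
      have hsplit := Finset.card_filter_add_card_filter_not
        (s := Finset.univ.filter fun x : G => x ^ 2 = 1) (fun x : G => x ∈ Z)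
      rw [Finset.filter_filter, Finset.filter_filter] at hsplit
      have e1 : (Finset.univ.filter fun x : G => x ^ 2 = 1 ∧ x ∈ Z) =
          Finset.univ.filter fun x : G => x ∈ Z ∧ x ^ 2 = 1 := by
        ext x; simp only [Finset.mem_filter, Finset.mem_univ, true_and, and_comm]
      have e2 : (Finset.univ.filter fun x : G => x ^ 2 = 1 ∧ x ∉ Z) =
          Finset.univ.filter fun x : G => x ∉ Z ∧ x ^ 2 = 1 := by
        ext x; simp only [Finset.mem_filter, Finset.mem_univ, true_and, and_comm]
      rw [e1, e2] at hsplit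
      omega
    -- squaring maps `{x⁴ = 1}` into the involutions of `Z`, with fibres inside translates of the involutions
    set S := Finset.univ.filter fun x : G => x ^ 4 = 1 with hS
    have hfib : ∀ y ∈ S.image (fun x => x ^ 2), (S.filter fun x => x ^ 2 = y).card ≤ 4 := by
      intro y hy
      obtain ⟨x₀, -, rfl⟩ := Finset.mem_image.1 hy
      refine le_trans (Finset.card_le_card_of_injOn (fun x => x * x₀⁻¹) ?_ ?_) hI
      · intro x hx
        simp only [Finset.coe_filter, Finset.mem_univ, true_and, Set.mem_setOf_eq] at hx ⊢
        rw [mul_pow, inv_pow, hx.2, mul_inv_cancel]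
      · intro x _ x' _ hxx'
        exact mul_right_cancel hxx'
    have himg : (S.image fun x => x ^ 2) ⊆ Finset.univ.filter fun x : G => x ∈ Z ∧ x ^ 2 = 1 := by
      intro y hy
      obtain ⟨x, hx, rfl⟩ := Finset.mem_image.1 hy
      simp only [hS, Finset.mem_filter, Finset.mem_univ, true_and] at hx ⊢
      refine ⟨Subgroup.sq_mem_of_index_two h2' x, ?_⟩
      rw [← pow_mul]
      exact hx
    calc S.card ≤ 4 * (S.image fun x => x ^ 2).card := Finset.card_le_mul_card_image _ _ hfib
      _ ≤ 4 * 2 := Nat.mul_le_mul_left _ (le_trans (Finset.card_le_card himg) hI_in)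
      _ = 8 := by norm_num

end Literature.GroupTheory.ThinObstruction
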